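import Literature.IUT.HodgeTheaters.InitialThetaDataLocalArrowClaims
import Literature.IUT.HodgeTheaters.InitialThetaDataArrowOpenProofs
import HarnessLib

/-!
# [IUTchI] Definition 3.1 (e)/(f): the printed §1 claims for the `K`-datum descend to every LOCAL datum
# `D.peLoc k ι` — part 2: `ArrowCoveringClaims` and `ArrowOpenClaims` for `C_v̲ := C_K ×_K K_v̲`

S. Mochizuki, *Inter-universal Teichmüller theory I*, §3, Def. 3.1 (e), (f) (kurims manuscript, May 2020, pp. 62–63)
[claim: Mochizuki2012, status: disputed]: (e) "we shall use the subscript `v̲` to denote the result of base-changing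
hyperbolic orbicurves over `F` or `K` to `K_v̲`"; (f) "open subgroups `Π_{X̲→_K} ⊆ Π_{C̲→_K} ⊆ Π_{C_F}` … and, for
`v ∈ V̲^good`, `Π_{X̲→_v} ⊆ Π_{C̲→_v} ⊆ Π_{C_v}`"; §1 p. 38 (the claims typed by abc-iut-L5-t1 as
`PuncturedEllipticData.ArrowCoveringClaims` — `jKer ⊴ Π_{C̲}`, `[Δ_{X̲} : jKer] = l`, `I_{ε′}·jKer = I_{ε″}·jKer = Δ_{X̲}`,
`Π_{X→} ∩ Δ_C = jKer`, `Π_{X→} ↠ G_k`, `Π_{X→} = Π_{X̲} ∩ Π_{C→}`, normal images, indices `2l`, `l`, cyclic quotients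
— and the openness clause `ArrowOpenClaims`).

PROOF-ONLY (theorems only; no definitions, no instances), over `InitialThetaDataLocalArrowClaims` (abc-iut-L5-t2).
MAIN THEOREMS: for the REAL Def. 3.1 datum `D`, `k = K_v̲ ⊆ Ω = k̄` Galois, `ι : F̄ → Ω`,
* **`arrowCoveringClaims_peLoc (hA : D.geom.pe.ArrowCoveringClaims) : (D.peLoc k ι).ArrowCoveringClaims`** — the typed
  printed claims of §1 p. 38 for the `K`-datum `(X_K, C̲_K, ε̲)` IMPLY the same claims for the base-changed datum of
  the local core `C_v̲` (so consumers binding labels / decomposition groups at `v̲`, abc-iut-L5-t4, cite the ONE named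
  hypothesis `hA`); every clause is transported along the closed embeddings `T`, `e` of the transport files:
  the geometric clauses through `T(jKer_v̲) = e(jKer)`, `T(Δ_{X̲,v̲}) = e(Δ_{X̲})`, `T(I_{x,v̲}) = e(I_x)` and injectivity of
  `T`; the Galois-group clauses through the comparison `Π_{C̲,v̲} ↠ Π_{C̲_K}/Π_{X̲→}` of part 1;
* **`arrowOpenClaims_peLoc (h : D.geom.pe.ArrowOpenClaims) (hA) : (D.peLoc k ι).ArrowOpenClaims`** — `Π_{X̲→}(C_v̲)`,
  `Π_{C̲→}(C_v̲)` are OPEN in `Π_{C_v̲}` (preimages of the open `Π_{X̲→_K}`, `Π_{C̲→_K} ⊆ Π_{C_F}` under `Π_{C_v̲} → Π_{C_F}`).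
Clause theorems: `peLoc_jKer_normal`, `peLoc_jKer_relindex`, `peLoc_inertia_ε1_sup`, `peLoc_inertia_ε2_sup`,
`peLoc_piXarrow_inf_delta`, `peLoc_cartesian` (with part 1's `peLoc_galX`, `peLoc_galC`).
Nothing of the series is asserted; the §1 claims enter only as hypotheses; no side is taken.
-/

noncomputable section

namespace Literature.IUT.HodgeTheaters

open Topology

universe u v w

namespace InitialThetaData

section PeLoc

variable {F : Type u} {K : Type v} {Fbar : Type w} [Field F] [NumberField F] [Field K] [NumberField K]
  [Algebra F K] [Field Fbar] [Algebra F Fbar] [Algebra K Fbar] [IsScalarTower F K Fbar] [Normal K Fbar]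
  [Algebra.IsIntegral F Fbar]
  {E : WeierstrassCurve F} [E.IsElliptic] {l : ℕ} {Pb : BadPlacePredicates K}
  (D : InitialThetaData F K Fbar E l Pb)
  {Ω : Type w} [Field Ω] [Algebra K Ω]
  (k : Type w) [Field k] [Algebra K k] [Algebra k Ω] [IsScalarTower K k Ω] [IsGalois k Ω] (ι : Fbar →ₐ[K] Ω)

/-- `T` is injective on subgroups of `Π_{C_v̲}` (the inclusion `Π_{C_v̲} ⊆ Π_{C_F} × Gal(Ω/k)` is injective).
[claim: Mochizuki2012, status: disputed] -/
theorem map_subtype_peLoc_injective :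
    Function.Injective (Subgroup.map (G := (D.peLoc k ι).PiC) (D.PiLoc D.PiCK (localToGF F k ι)).subtype) :=
  Subgroup.map_injective (D.PiLoc D.PiCK (localToGF F k ι)).subtype_injective

/-! ### The geometric clauses -/

/-- **Local `jKer_normal`**: `jKer_v̲ ⊴ Π_{C̲,v̲}` — conjugating `e(j)` by `(embK c, τ) ∈ Π_{C̲,v̲}` gives `e(c j c⁻¹)`, and
`jKer ⊴ Π_{C̲_K}` (the `K`-level claim). [claim: Mochizuki2012, status: disputed] -/
theorem peLoc_jKer_normal (hA : D.geom.pe.ArrowCoveringClaims) :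
    ((D.peLoc k ι).jKer.subgroupOf (D.peLoc k ι).PiCbar).Normal := by
  rw [Subgroup.normal_subgroupOf_iff (le_sup_right.trans (D.peLoc k ι).piXarrow_le_piCbar)]
  intro h c hh hc
  obtain ⟨j, hj, hje⟩ := (D.mem_peLoc_iff_of_map_eq k ι (D.map_subtype_peLoc_jKer k ι) h).mp hh
  have hc' : D.fstLoc D.PiCK (localToGF F k ι) c ∈ D.PiCund := hc
  obtain ⟨c₀, hc₀, hce⟩ := hc'
  have hconj : c₀ * j * c₀⁻¹ ∈ D.geom.pe.jKer :=
    (Subgroup.normal_subgroupOf_iff (le_sup_right.trans D.geom.pe.piXarrow_le_piCbar)).mp hA.jKer_normal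
      j c₀ hj hc₀
  refine (D.mem_peLoc_iff_of_map_eq k ι (D.map_subtype_peLoc_jKer k ι) _).mpr ⟨c₀ * j * c₀⁻¹, hconj, ?_⟩
  have h1 : (D.PiLoc D.PiCK (localToGF F k ι)).subtype c =
      (D.geom.embK c₀, ((D.PiLoc D.PiCK (localToGF F k ι)).subtype c).2) := Prod.ext hce.symm rfl
  change D.embLoc k (c₀ * j * c₀⁻¹) = (D.PiLoc D.PiCK (localToGF F k ι)).subtype c *
    (D.PiLoc D.PiCK (localToGF F k ι)).subtype h * ((D.PiLoc D.PiCK (localToGF F k ι)).subtype c)⁻¹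
  rw [← hje, h1, embLoc_apply, embLoc_apply]
  refine Prod.ext ?_ ?_
  · simp only [Prod.fst_mul, Prod.fst_inv, map_mul, map_inv]
  · simp only [Prod.snd_mul, Prod.snd_inv, mul_one, mul_inv_cancel]

/-- **Local `jKer_relindex`**: `[Δ_{X̲,v̲} : jKer_v̲] = [Δ_{X̲} : jKer] = l` (both transported along `T`, `e`).
[claim: Mochizuki2012, status: disputed] -/
theorem peLoc_jKer_relindex (hA : D.geom.pe.ArrowCoveringClaims) :
    (D.peLoc k ι).jKer.relIndex (D.peLoc k ι).DeltaXbar = (D.peLoc k ι).l := by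
  rw [← Subgroup.relIndex_map_map_of_injective (D.peLoc k ι).jKer (D.peLoc k ι).DeltaXbar
      (D.PiLoc D.PiCK (localToGF F k ι)).subtype_injective,
    map_subtype_peLoc_jKer, map_subtype_peLoc_deltaXbar,
    Subgroup.relIndex_map_map_of_injective _ _ (D.embLoc_injective k), hA.jKer_relindex]
  rfl

/-- **Local `inertia_ε1_sup`**: `I_{ε′,v̲} · jKer_v̲ = Δ_{X̲,v̲}` (`= e(I_{ε′} · jKer) = e(Δ_{X̲})`).
[claim: Mochizuki2012, status: disputed] -/
theorem peLoc_inertia_ε1_sup (hA : D.geom.pe.ArrowCoveringClaims) :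
    (D.peLoc k ι).inertia (D.peLoc k ι).ε1 ⊔ (D.peLoc k ι).jKer = (D.peLoc k ι).DeltaXbar := by
  apply D.map_subtype_peLoc_injective k ι
  rw [Subgroup.map_sup, map_subtype_peLoc_inertia, map_subtype_peLoc_jKer, map_subtype_peLoc_deltaXbar,
    ← Subgroup.map_sup, show (D.peLoc k ι).ε1 = D.geom.pe.ε1 from rfl, hA.inertia_ε1_sup]

/-- **Local `inertia_ε2_sup`**: `I_{ε″,v̲} · jKer_v̲ = Δ_{X̲,v̲}`. [claim: Mochizuki2012, status: disputed] -/
theorem peLoc_inertia_ε2_sup (hA : D.geom.pe.ArrowCoveringClaims) :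
    (D.peLoc k ι).inertia (D.peLoc k ι).ε2 ⊔ (D.peLoc k ι).jKer = (D.peLoc k ι).DeltaXbar := by
  apply D.map_subtype_peLoc_injective k ι
  rw [Subgroup.map_sup, map_subtype_peLoc_inertia, map_subtype_peLoc_jKer, map_subtype_peLoc_deltaXbar,
    ← Subgroup.map_sup, show (D.peLoc k ι).ε2 = D.geom.pe.ε2 from rfl, hA.inertia_ε2_sup]

/-- **Local `piXarrow_inf_delta`** ("`σ_v̲` is a section"): `Π_{X̲→}(C_v̲) ∩ Δ_{C,v̲} = jKer_v̲` (`= e(jKer)`).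
[claim: Mochizuki2012, status: disputed] -/
theorem peLoc_piXarrow_inf_delta (hA : D.geom.pe.ArrowCoveringClaims) :
    (D.peLoc k ι).piXarrow ⊓ (D.peLoc k ι).DeltaC = (D.peLoc k ι).jKer := by
  apply D.map_subtype_peLoc_injective k ι
  rw [D.map_subtype_peLoc_piXarrow_inf_deltaC k ι hA, map_subtype_peLoc_jKer]

/-- **Local `cartesian`**: `Π_{X̲→}(C_v̲) = Π_{X̲,v̲} ∩ Π_{C̲→}(C_v̲)` (base change of `Π_{X̲→_K} = Π_{X̲_K} ∩ Π_{C̲→_K}`).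
[claim: Mochizuki2012, status: disputed] -/
theorem peLoc_cartesian (hA : D.geom.pe.ArrowCoveringClaims) :
    (D.peLoc k ι).piXarrow = (D.peLoc k ι).PiXbar ⊓ (D.peLoc k ι).piCarrow := by
  apply D.map_subtype_peLoc_injective k ι
  rw [D.map_subtype_peLoc_piXarrow_eq k ι hA, Subgroup.map_inf_eq (D.peLoc k ι).PiXbar (D.peLoc k ι).piCarrow,
    map_subtype_peLoc_PiXbar, D.map_subtype_peLoc_piCarrow_eq k ι hA, ← PiLoc_inf]
  · congr 1
    show D.geom.pe.piXarrow.map D.geom.embK = D.geom.pe.PiXbar.map D.geom.embK ⊓ D.geom.pe.piCarrow.map D.geom.embK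
    rw [← Subgroup.map_inf_eq _ _ _ D.geom.embK_injective, ← hA.cartesian]
  · exact (D.PiLoc D.PiCK (localToGF F k ι)).subtype_injective

/-! ### The assembled claims for the local datum -/

/-- **The printed §1 claims for the `K`-datum imply them for the local datum of `C_v̲ := C_K ×_K K_v̲`**
(`k = K_v̲`, `Ω = k̄`, any `K`-embedding `ι : F̄ → Ω`): `(D.peLoc k ι).ArrowCoveringClaims` from
`D.geom.pe.ArrowCoveringClaims` (abc-iut-L5-t1's `arrowCoveringClaims_iff_of_aug` supplies the derivable clause
`Π_{X→} ↠ G_k`). [claim: Mochizuki2012, status: disputed] -/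
theorem arrowCoveringClaims_peLoc (hA : D.geom.pe.ArrowCoveringClaims) : (D.peLoc k ι).ArrowCoveringClaims := by
  obtain ⟨hXn, hXi, hXc⟩ := D.peLoc_galX k ι hA
  obtain ⟨hCn, hCi, hCc⟩ := D.peLoc_galC k ι hA
  exact ((D.peLoc k ι).arrowCoveringClaims_iff_of_aug).mpr
    ⟨D.peLoc_jKer_normal k ι hA, D.peLoc_jKer_relindex k ι hA, D.peLoc_inertia_ε1_sup k ι hA,
      D.peLoc_inertia_ε2_sup k ι hA, D.peLoc_piXarrow_inf_delta k ι hA, D.peLoc_cartesian k ι hA, hXn, hCn,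
      hXi, hCi, fun {_} => hXc, fun {_} => hCc⟩

/-- **The §1 openness clause descends to the local datum**: given it and the §1 claims for the `K`-datum,
`Π_{X̲→}(C_v̲) = fstLoc⁻¹(Π_{X̲→_K})` and `Π_{C̲→}(C_v̲) = fstLoc⁻¹(Π_{C̲→_K})` are OPEN in `Π_{C_v̲}` (`Π_{X̲→_K}`,
`Π_{C̲→_K}` open in `Π_{C_F}` by `isOpen_PiXarrow_of_arrowOpenClaims`, and `Π_{C_v̲} → Π_{C_F}` is continuous).
[claim: Mochizuki2012, status: disputed] -/
theorem arrowOpenClaims_peLoc (h : D.geom.pe.ArrowOpenClaims) (hA : D.geom.pe.ArrowCoveringClaims) :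
    (D.peLoc k ι).ArrowOpenClaims := by
  refine ⟨?_, ?_⟩
  · rw [D.peLoc_piXarrow_eq_comap k ι hA]
    exact (D.isOpen_PiXarrow_of_arrowOpenClaims h).preimage (D.continuous_fstLoc D.PiCK (localToGF F k ι))
  · rw [D.peLoc_piCarrow_eq_comap k ι hA]
    exact (D.isOpen_PiCarrow_of_arrowOpenClaims h).preimage (D.continuous_fstLoc D.PiCK (localToGF F k ι))

end PeLoc

end InitialThetaData

end Literature.IUT.HodgeTheaters

end
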